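import Summits.QuantumFields.YangMills.Theorems.UnitScaleTiltProp7PinnedFlatCoercivitySrc
import Summits.QuantumFields.YangMills.Theorems.UnitScaleTiltProp7PointLandauDivergence
import HarnessLib

/-!
# Route `UnitScaleTilt`, crux K1 «MinimiserStabilityRegPr» (stmt-QuantumFields-19200), line «route-R» — GROWTH row N8 (W-SEAT MAP #3 M8), file F4:
# THE k-UNIFORM READING OF THE INHOMOGENEOUS PINNED COERCIVITY — SKEW∕HERMITIAN SPLIT.  If the off-centre divergence of `Y` is HERMITIAN (the pinned
# `ℓ²`-optimum: ✓ p605285 `divB_optimalRepr_eq`), the skew part `Y − Yᴴ` is EXACTLY pinned and F1 (✓ p606158) bounds it; the Hermitian part `Y + Yᴴ = −YᴴY`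
# costs `N·s²` of the mass with NO lattice factor.  Net: `(1 − N s²∕4)·Σ‖Y‖²_F ≤ C₁(L,N)(L^k)²Σ‖∂Y‖²_F + 28L^k·Σ‖Q^{(k)}Y‖²_F` — no divergence source, no `(L^k)^3`.

Cell `ym3-torus`, D-0154 (3c) twin-width seat `ym-routeR-w1` (gen 0); `--supports stmt-QuantumFields-19200 --as helper`; THEOREMS ONLY (0 `def`, 0 `sorry`).
YM₃ on T³ is a ladder rung (R3), not the Clay problem; nothing here claims the stub, the crux, d = 4 or the mass gap.

WHY (numbers).  The literal M8 row carries the off-centre divergence `g` with the sharp weight `(L^k)^3` (F2∕F3; point capacity in d = 3), and the nonlinear pinned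
optimum only gives `‖g(x)‖ ≤ ½Σ_{b∋x}‖Y_b‖²` (✓ p605285), i.e. `Σ‖g‖² ≤ 6s²·MASS`: the absorption `(L^k)^3·s² ≪ 1` is NOT uniform in `k` at `s = ε·L^{-k}`.  But p605285's
identity says more: `D^*Y` off the centres is HERMITIAN.  Since `ᴴ` commutes with `∂^*`, `∂`, and with every composite `Q^{(k)}` of the flat linearised average
(`linAvg` has the real coefficients `|Idx|⁻¹` on signed walk sums), the skew field `A′ := Y − Yᴴ` has `∂^*A′ = 0` off the centres EXACTLY, `∂A′ = ∂Y − (∂Y)ᴴ`,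
`Q^{(k)}A′ = Q^{(k)}Y − (Q^{(k)}Y)ᴴ`; F1 applies to `A′` with Frobenius sources `≤ 4×` those of `Y`; and `Σ|Y|²_F = ¼(Σ|Y − Yᴴ|²_F + Σ|Y + Yᴴ|²_F)` (parallelogram),
where for `Y = V − 1`, `V` unitary, `Y + Yᴴ = −YᴴY` has `Σ|·|²_F ≤ N·‖Y‖²·Σ|Y|²_F`.

WHAT IS PROVED (sorry-free, no definition; `M_N(ℂ)`-valued bond fields on the finest torus, Frobenius sums `Σ_{a,b}|·_{ab}|²`, lattice factor `1`):
* §1 `sum_normSq_conjTranspose`, `sum_normSq_eq_quarter_skew_add_herm` (parallelogram), `sum_normSq_sub_conjTranspose_le` (`≤ 4Σ|M|²`),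
  `sum_normSq_add_conjTranspose_le_of_unitary` (`V` unitary, `‖V − 1‖ ≤ s`: `Σ|(Y + Yᴴ)_{ab}|² ≤ N·s²·Σ|Y_{ab}|²`, `Y = V − 1`).
* §2 `diverg_sub_conjTranspose`, `curl_sub_conjTranspose`, `walkSum_conjTranspose`, `linAvg_conjTranspose`, `iterQ_conjTranspose`, `iterQ_sub`,
  `iterQ_sub_conjTranspose` — the skew projection commutes with `∂^*`, `∂`, `linAvg` and every composite `Q^{(k)}` (`hQ0`, `hQs`).
* §3 ★★ `sum_normSq_skew_le_curl_add_avg_of_hermDiv` (`d = 3`, `k ≤ m + K`): if `(∂^*Y)(x)ᴴ = (∂^*Y)(x)` at every `x ∉ Set.range (embIter k)`, then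
  `Σ_b Σ|(Y − Yᴴ)(b)_{ab′}|² ≤ 4·[(8400N²L⁴∕(√L−1)² + 97∕8)(L^k)²·Σ_pΣ|(∂Y)(p)_{ab′}|² + 28L^k·Σ_cΣ|(Q^{(k)}Y)(c)_{ab′}|²]`.
* §4 ★★ `sum_normSq_le_of_hermDiv_of_hermBudget` (abstract budget `Σ|Y + Yᴴ|²_F ≤ θ·Σ|Y|²_F`: `(1 − θ∕4)·MASS ≤ …`) and ★★ `sum_normSq_le_of_hermDiv_of_polar`
  (`Y b = V b − 1`, `V b` unitary, `‖Y b‖ ≤ s`: `(1 − N s²∕4)·MASS ≤ C₁(L^k)²·CURL_F + 28L^k·AVG_F`) — k-UNIFORM, no divergence source.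

HONEST SCOPE.  Flat background (`U₀ = 1`, lattice `∂^*`); the curved reading needs the covariant twin of F1 (route-R (S2), L-sized per OWNER 03:20Z) — the algebra of
§1–§2 is background-independent (`(D^*_{U₀}Y)ᴴ = D^*_{U₀}(Yᴴ)` for unitary `U₀`).  Nothing of Bałaban's analysis is asserted.

References: T. Bałaban, CMP 95 (1984) 17–40 [Balaban1984PropagatorsI] (Prop. 1.1 (1.90) p.33, (1.18)–(1.21)); CMP 98 (1985) 17–51 [Balaban1985Averaging]
((124)–(125) p.36); CMP 102 (1985) 277–309 [Balaban1985Variational] (Prop. 7 p.299, (4) p.278, (21) p.281).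
-/

set_option autoImplicit false

noncomputable section

open scoped BigOperators Matrix.Norms.L2Operator Matrix

namespace Summit.QuantumFields.YangMills.Theorems.Prop7PinnedSkewSplit

open Literature.MathematicalPhysics.QuantumFieldTheory.Balaban1983to89
open Finset T4Continuum BlockAveraging BlockAveragingEMLLinearised LatticeFieldCalculus
open B15DeterminingSets (embIter)
open Summit.QuantumFields.YangMills.Theorems.Prop7AvgLinearisation (linAvg_sub)
open Summit.QuantumFields.YangMills.Theorems.Prop7PinnedFlatCoercivity (sum_normSq_le_mul_opNorm_sq opNorm_sq_le_sum_normSq sum_normSq_sub_le)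
open Summit.QuantumFields.YangMills.Theorems.Prop7PinnedFlatCoercivitySrc (sum_normSq_le_curl_add_avg_of_pinned)
open Summit.QuantumFields.YangMills.Theorems.Prop7PointLandauDivergence (add_conjTranspose_eq_neg_mul)

variable {P : Params} {N : ℕ}

/-! ## §1 Matrix algebra: Frobenius sums of `Mᴴ`, the parallelogram identity, the skew part, the unitary polarisation -/

/-- `Σ_{a,b}|Mᴴ_{ab}|² = Σ_{a,b}|M_{ab}|²`. [folklore] -/
theorem sum_normSq_conjTranspose (M : Matrix (Fin N) (Fin N) ℂ) :
    ∑ a : Fin N, ∑ b : Fin N, Complex.normSq ((Mᴴ) a b) = ∑ a : Fin N, ∑ b : Fin N, Complex.normSq (M a b) := by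
  rw [Finset.sum_comm]
  refine Finset.sum_congr rfl fun a _ => Finset.sum_congr rfl fun b _ => ?_
  rw [Matrix.conjTranspose_apply, Complex.star_def, Complex.normSq_conj]

/-- **PARALLELOGRAM**: `Σ|M|²_F = ¼(Σ|M − Mᴴ|²_F + Σ|M + Mᴴ|²_F)`. [folklore] -/
theorem sum_normSq_eq_quarter_skew_add_herm (M : Matrix (Fin N) (Fin N) ℂ) :
    ∑ a : Fin N, ∑ b : Fin N, Complex.normSq (M a b)
      = (1 / 4) * (∑ a : Fin N, ∑ b : Fin N, Complex.normSq ((M - Mᴴ) a b) + ∑ a : Fin N, ∑ b : Fin N, Complex.normSq ((M + Mᴴ) a b)) := by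
  have hpar : ∑ a : Fin N, ∑ b : Fin N, Complex.normSq ((M - Mᴴ) a b) + ∑ a : Fin N, ∑ b : Fin N, Complex.normSq ((M + Mᴴ) a b)
      = 2 * ∑ a : Fin N, ∑ b : Fin N, Complex.normSq (M a b) + 2 * ∑ a : Fin N, ∑ b : Fin N, Complex.normSq ((Mᴴ) a b) := by
    rw [Finset.mul_sum, Finset.mul_sum, ← Finset.sum_add_distrib, ← Finset.sum_add_distrib]
    refine Finset.sum_congr rfl fun a _ => ?_
    rw [Finset.mul_sum, Finset.mul_sum, ← Finset.sum_add_distrib, ← Finset.sum_add_distrib]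
    refine Finset.sum_congr rfl fun b _ => ?_
    simp only [Matrix.sub_apply, Matrix.add_apply, Prop7MatrixHodgeSplit.normSq_eq_re_sq_add_im_sq, Complex.sub_re, Complex.sub_im, Complex.add_re,
      Complex.add_im]
    ring
  rw [hpar, sum_normSq_conjTranspose]
  ring

/-- `Σ|(M − Mᴴ)_{ab}|² ≤ 4·Σ|M_{ab}|²`. [folklore] -/
theorem sum_normSq_sub_conjTranspose_le (M : Matrix (Fin N) (Fin N) ℂ) :
    ∑ a : Fin N, ∑ b : Fin N, Complex.normSq ((M - Mᴴ) a b) ≤ 4 * ∑ a : Fin N, ∑ b : Fin N, Complex.normSq (M a b) := by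
  have h := sum_normSq_sub_le M Mᴴ
  rw [sum_normSq_conjTranspose] at h
  linarith

/-- **THE UNITARY POLARISATION IN FROBENIUS FORM**: for `V` unitary with `‖V − 1‖ ≤ s` (operator norm), `Y := V − 1` has `Y + Yᴴ = −YᴴY`, hence
`Σ|(Y + Yᴴ)_{ab}|² ≤ N·s²·Σ|Y_{ab}|²` (Frobenius ≤ `N`·op², `‖YᴴY‖ ≤ ‖Y‖²`, op² ≤ Frobenius). [cite: Balaban1985Variational, (4) p.278] -/
theorem sum_normSq_add_conjTranspose_le_of_unitary {V : Matrix (Fin N) (Fin N) ℂ} (hV : V ∈ Matrix.unitaryGroup (Fin N) ℂ) {s : ℝ} (hs : ‖V - 1‖ ≤ s) :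
    ∑ a : Fin N, ∑ b : Fin N, Complex.normSq (((V - 1) + (V - 1)ᴴ : Matrix (Fin N) (Fin N) ℂ) a b)
      ≤ N * s ^ 2 * ∑ a : Fin N, ∑ b : Fin N, Complex.normSq ((V - 1 : Matrix (Fin N) (Fin N) ℂ) a b) := by
  set Y : Matrix (Fin N) (Fin N) ℂ := V - 1 with hY
  have hs0 : 0 ≤ s := (norm_nonneg _).trans hs
  rw [add_conjTranspose_eq_neg_mul hV]
  have hneg : ∀ (M : Matrix (Fin N) (Fin N) ℂ), ∑ a : Fin N, ∑ b : Fin N, Complex.normSq ((-M) a b) = ∑ a : Fin N, ∑ b : Fin N, Complex.normSq (M a b) :=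
    fun M => Finset.sum_congr rfl fun a _ => Finset.sum_congr rfl fun b _ => by rw [Matrix.neg_apply, Complex.normSq_neg]
  rw [hneg]
  have h1 := sum_normSq_le_mul_opNorm_sq (Yᴴ * Y)
  have h2 : ‖Yᴴ * Y‖ ≤ s * ‖Y‖ :=
    (Matrix.l2_opNorm_mul _ _).trans (by rw [Matrix.l2_opNorm_conjTranspose]; exact mul_le_mul_of_nonneg_right hs (norm_nonneg _))
  have h3 : ‖Yᴴ * Y‖ ^ 2 ≤ s ^ 2 * ‖Y‖ ^ 2 := by
    rw [← mul_pow]; exact pow_le_pow_left₀ (norm_nonneg _) h2 2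
  have h4 := opNorm_sq_le_sum_normSq Y
  have hN : (0 : ℝ) ≤ N := Nat.cast_nonneg _
  calc ∑ a : Fin N, ∑ b : Fin N, Complex.normSq ((Yᴴ * Y) a b) ≤ N * ‖Yᴴ * Y‖ ^ 2 := h1
    _ ≤ N * (s ^ 2 * ‖Y‖ ^ 2) := mul_le_mul_of_nonneg_left h3 hN
    _ ≤ N * (s ^ 2 * ∑ a : Fin N, ∑ b : Fin N, Complex.normSq (Y a b)) :=
        mul_le_mul_of_nonneg_left (mul_le_mul_of_nonneg_left h4 (sq_nonneg _)) hN
    _ = N * s ^ 2 * ∑ a : Fin N, ∑ b : Fin N, Complex.normSq (Y a b) := by ring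

/-! ## §2 The skew projection commutes with `∂^*`, `∂`, `linAvg`, and every composite `Q^{(k)}` -/

section Lattice

variable {j : ℕ} {n : Type*}

/-- `∂^*(Y − Yᴴ)(x) = (∂^*Y)(x) − (∂^*Y)(x)ᴴ` (`∂^*` is a signed sum of values; `ᴴ` is additive). [folklore] -/
theorem diverg_sub_conjTranspose (Y : PBond P j → Matrix n n ℂ) (x : Site P j) :
    diverg 1 (fun e => Y e - (Y e)ᴴ) x = diverg 1 Y x - (diverg 1 Y x)ᴴ := by
  simp only [diverg, one_smul, Matrix.conjTranspose_sum, Matrix.conjTranspose_sub, ← Finset.sum_sub_distrib]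
  exact Finset.sum_congr rfl fun μ _ => by abel

/-- `∂(Y − Yᴴ)(p) = (∂Y)(p) − (∂Y)(p)ᴴ`. [folklore] -/
theorem curl_sub_conjTranspose (Y : PBond P j → Matrix n n ℂ) (p : Plaq P j) :
    curl 1 (fun e => Y e - (Y e)ᴴ) p = curl 1 Y p - (curl 1 Y p)ᴴ := by
  simp only [curl, one_smul, Matrix.conjTranspose_sub, Matrix.conjTranspose_add]
  abel

/-- `ᴴ` passes through signed walk sums. [cite: Balaban1984PropagatorsI, (1.8) p.19 (bookkeeping)] -/
theorem walkSum_conjTranspose (Y : PBond P j → Matrix n n ℂ) :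
    ∀ γ : List (LStep P j), walkSum (fun b => (Y b)ᴴ) γ = (walkSum Y γ)ᴴ
  | [] => by simp [walkSum]
  | s :: γ => by
    rw [walkSum_cons, walkSum_cons, walkSum_conjTranspose Y γ, Matrix.conjTranspose_add]
    split_ifs <;> simp [Matrix.conjTranspose_neg]

/-- **`linAvg` COMMUTES WITH `ᴴ`**: the flat linearised average has the real coefficients `|Idx|⁻¹` on signed walk sums. [cite: Balaban1985Averaging, (124)-(125) p.36] -/
theorem linAvg_conjTranspose (Y : PBond P j → Matrix n n ℂ) (c : PBond P (j + 1)) :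
    linAvg (fun b => (Y b)ᴴ) c = (linAvg Y c)ᴴ := by
  rw [linAvg_def, linAvg_def, Matrix.conjTranspose_inv_natCast_smul, Matrix.conjTranspose_sum]
  congr 1
  refine Finset.sum_congr rfl fun i _ => ?_
  rw [Matrix.conjTranspose_sub, Matrix.conjTranspose_add, walkSum_conjTranspose, walkSum_conjTranspose, walkSum_conjTranspose]

variable (Q : (i : ℕ) → (PBond P 0 → Matrix n n ℂ) → PBond P i → Matrix n n ℂ)
  (hQ0 : ∀ Y, Q 0 Y = Y) (hQs : ∀ (i : ℕ) (Y : PBond P 0 → Matrix n n ℂ) (c : PBond P (i + 1)), Q (i + 1) Y c = linAvg (Q i Y) c)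
include hQ0 hQs

/-- **EVERY COMPOSITE `Q^{(k)}` COMMUTES WITH `ᴴ`** (induction on `k` through `hQ0`, `hQs`). [cite: Balaban1985Averaging, (124)-(125) p.36] -/
theorem iterQ_conjTranspose : ∀ (k : ℕ) (Y : PBond P 0 → Matrix n n ℂ) (c : PBond P k), Q k (fun b => (Y b)ᴴ) c = (Q k Y c)ᴴ
  | 0, Y, c => by rw [hQ0, hQ0]
  | k + 1, Y, c => by
    have ih : Q k (fun b => (Y b)ᴴ) = fun b => (Q k Y b)ᴴ := funext fun b => iterQ_conjTranspose k Y b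
    rw [hQs, hQs, ih, linAvg_conjTranspose]

/-- every composite `Q^{(k)}` is subtractive (`linAvg_sub`, induction on `k`). [cite: Balaban1985Averaging, (124)-(125) p.36] -/
theorem iterQ_sub : ∀ (k : ℕ) (Y Y' : PBond P 0 → Matrix n n ℂ) (c : PBond P k), Q k (fun b => Y b - Y' b) c = Q k Y c - Q k Y' c
  | 0, Y, Y', c => by rw [hQ0, hQ0, hQ0]
  | k + 1, Y, Y', c => by
    have ih : Q k (fun b => Y b - Y' b) = fun b => Q k Y b - Q k Y' b := funext fun b => iterQ_sub k Y Y' b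
    rw [hQs, hQs, hQs, ih, linAvg_sub]

/-- `Q^{(k)}(Y − Yᴴ)(c) = (Q^{(k)}Y)(c) − (Q^{(k)}Y)(c)ᴴ`. [cite: Balaban1985Averaging, (124)-(125) p.36] -/
theorem iterQ_sub_conjTranspose (k : ℕ) (Y : PBond P 0 → Matrix n n ℂ) (c : PBond P k) :
    Q k (fun b => Y b - (Y b)ᴴ) c = Q k Y c - (Q k Y c)ᴴ := by
  rw [iterQ_sub Q hQ0 hQs k Y (fun b => (Y b)ᴴ) c, iterQ_conjTranspose Q hQ0 hQs k Y c]

end Lattice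

/-! ## §3 The skew part is pinned when the off-centre divergence is Hermitian: F1 applied to `Y − Yᴴ` -/

/-- ★★ **THE SKEW PART UNDER A HERMITIAN OFF-CENTRE DIVERGENCE** (`d = 3`, `k ≤ m + K`): if `(∂^*Y)(x)ᴴ = (∂^*Y)(x)` at every finest site off the `k`-centres,
then `A′ := Y − Yᴴ` has `∂^*A′ = 0` there, and F1 gives
`Σ_b |A′(b)|²_F ≤ 4·[(8400N²L⁴∕(√L − 1)² + 97∕8)·(L^k)²·Σ_p |(∂Y)(p)|²_F + 28·L^k·Σ_c |(Q^{(k)}Y)(c)|²_F]`.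
[cite: Balaban1984PropagatorsI, Prop. 1.1 (1.90) p.33; Balaban1985Variational, Prop. 7 p.299] -/
theorem sum_normSq_skew_le_curl_add_avg_of_hermDiv (hd : P.d = 3) [NeZero N]
    (Q : (i : ℕ) → (PBond P 0 → Matrix (Fin N) (Fin N) ℂ) → PBond P i → Matrix (Fin N) (Fin N) ℂ)
    (hQ0 : ∀ Y, Q 0 Y = Y)
    (hQs : ∀ (i : ℕ) (Y : PBond P 0 → Matrix (Fin N) (Fin N) ℂ) (c : PBond P (i + 1)), Q (i + 1) Y c = linAvg (Q i Y) c)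
    (Y : PBond P 0 → Matrix (Fin N) (Fin N) ℂ) {k : ℕ} (hk : k ≤ P.m + P.K)
    (hherm : ∀ x : Site P 0, x ∉ Set.range (embIter k) → (diverg 1 Y x)ᴴ = diverg 1 Y x) :
    ∑ b : PBond P 0, ∑ a : Fin N, ∑ b' : Fin N, Complex.normSq ((Y b - (Y b)ᴴ) a b')
      ≤ 4 * ((8400 * (N : ℝ) ^ 2 * (P.L : ℝ) ^ 4 / (Real.sqrt P.L - 1) ^ 2 + 97 / 8) * ((P.L : ℝ) ^ k) ^ 2
          * ∑ p : Plaq P 0, ∑ a : Fin N, ∑ b' : Fin N, Complex.normSq ((curl 1 Y p) a b')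
        + 28 * (P.L : ℝ) ^ k * ∑ c : PBond P k, ∑ a : Fin N, ∑ b' : Fin N, Complex.normSq ((Q k Y c) a b')) := by
  -- the skew field is pinned
  have hpin : ∀ x : Site P 0, x ∉ Set.range (embIter k) → diverg 1 (fun e => Y e - (Y e)ᴴ) x = 0 := fun x hx => by
    rw [diverg_sub_conjTranspose, hherm x hx, sub_self]
  have hF1 := sum_normSq_le_curl_add_avg_of_pinned hd Q hQ0 hQs (fun e => Y e - (Y e)ᴴ) hk hpin
  -- its sources are the skew parts of the sources of `Y`
  have hcurl : ∀ p : Plaq P 0, curl 1 (fun e => Y e - (Y e)ᴴ) p = curl 1 Y p - (curl 1 Y p)ᴴ := curl_sub_conjTranspose Y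
  have hQ : ∀ c : PBond P k, Q k (fun e => Y e - (Y e)ᴴ) c = Q k Y c - (Q k Y c)ᴴ := iterQ_sub_conjTranspose Q hQ0 hQs k Y
  simp only [hcurl, hQ] at hF1
  have hC0 : 0 ≤ (8400 * (N : ℝ) ^ 2 * (P.L : ℝ) ^ 4 / (Real.sqrt P.L - 1) ^ 2 + 97 / 8) * ((P.L : ℝ) ^ k) ^ 2 := by positivity
  have h28 : 0 ≤ 28 * (P.L : ℝ) ^ k := by positivity
  have hcurl4 : ∑ p : Plaq P 0, ∑ a : Fin N, ∑ b' : Fin N, Complex.normSq ((curl 1 Y p - (curl 1 Y p)ᴴ) a b')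
      ≤ 4 * ∑ p : Plaq P 0, ∑ a : Fin N, ∑ b' : Fin N, Complex.normSq ((curl 1 Y p) a b') := by
    rw [Finset.mul_sum]; exact Finset.sum_le_sum fun p _ => sum_normSq_sub_conjTranspose_le _
  have hQ4 : ∑ c : PBond P k, ∑ a : Fin N, ∑ b' : Fin N, Complex.normSq ((Q k Y c - (Q k Y c)ᴴ) a b')
      ≤ 4 * ∑ c : PBond P k, ∑ a : Fin N, ∑ b' : Fin N, Complex.normSq ((Q k Y c) a b') := by
    rw [Finset.mul_sum]; exact Finset.sum_le_sum fun c _ => sum_normSq_sub_conjTranspose_le _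
  have h1 := mul_le_mul_of_nonneg_left hcurl4 hC0
  have h2 := mul_le_mul_of_nonneg_left hQ4 h28
  linarith [hF1, h1, h2]

/-! ## §4 The full mass: parallelogram + a Hermitian-part budget (abstract, and from the unitary polarisation) — k-UNIFORM, no divergence source -/

/-- ★★ **MASS BOUND UNDER A HERMITIAN-PART BUDGET** (`d = 3`, `k ≤ m + K`): Hermitian off-centre divergence and `Σ_b |Y + Yᴴ|²_F ≤ θ·Σ_b |Y|²_F` give
`(1 − θ∕4)·Σ_b |Y(b)|²_F ≤ (8400N²L⁴∕(√L − 1)² + 97∕8)·(L^k)²·Σ_p |(∂Y)(p)|²_F + 28·L^k·Σ_c |(Q^{(k)}Y)(c)|²_F`.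
[cite: Balaban1984PropagatorsI, Prop. 1.1 (1.90) p.33; Balaban1985Variational, Prop. 7 p.299] -/
theorem sum_normSq_le_of_hermDiv_of_hermBudget (hd : P.d = 3) [NeZero N]
    (Q : (i : ℕ) → (PBond P 0 → Matrix (Fin N) (Fin N) ℂ) → PBond P i → Matrix (Fin N) (Fin N) ℂ)
    (hQ0 : ∀ Y, Q 0 Y = Y)
    (hQs : ∀ (i : ℕ) (Y : PBond P 0 → Matrix (Fin N) (Fin N) ℂ) (c : PBond P (i + 1)), Q (i + 1) Y c = linAvg (Q i Y) c)
    (Y : PBond P 0 → Matrix (Fin N) (Fin N) ℂ) {k : ℕ} (hk : k ≤ P.m + P.K)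
    (hherm : ∀ x : Site P 0, x ∉ Set.range (embIter k) → (diverg 1 Y x)ᴴ = diverg 1 Y x)
    (θ : ℝ) (hθ : ∑ b : PBond P 0, ∑ a : Fin N, ∑ b' : Fin N, Complex.normSq ((Y b + (Y b)ᴴ) a b')
      ≤ θ * ∑ b : PBond P 0, ∑ a : Fin N, ∑ b' : Fin N, Complex.normSq ((Y b) a b')) :
    (1 - θ / 4) * ∑ b : PBond P 0, ∑ a : Fin N, ∑ b' : Fin N, Complex.normSq ((Y b) a b')
      ≤ (8400 * (N : ℝ) ^ 2 * (P.L : ℝ) ^ 4 / (Real.sqrt P.L - 1) ^ 2 + 97 / 8) * ((P.L : ℝ) ^ k) ^ 2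
          * ∑ p : Plaq P 0, ∑ a : Fin N, ∑ b' : Fin N, Complex.normSq ((curl 1 Y p) a b')
        + 28 * (P.L : ℝ) ^ k * ∑ c : PBond P k, ∑ a : Fin N, ∑ b' : Fin N, Complex.normSq ((Q k Y c) a b') := by
  have hA := sum_normSq_skew_le_curl_add_avg_of_hermDiv hd Q hQ0 hQs Y hk hherm
  have hpar : ∑ b : PBond P 0, ∑ a : Fin N, ∑ b' : Fin N, Complex.normSq ((Y b) a b')
      = (1 / 4) * (∑ b : PBond P 0, ∑ a : Fin N, ∑ b' : Fin N, Complex.normSq ((Y b - (Y b)ᴴ) a b')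
          + ∑ b : PBond P 0, ∑ a : Fin N, ∑ b' : Fin N, Complex.normSq ((Y b + (Y b)ᴴ) a b')) := by
    rw [mul_add, Finset.mul_sum, Finset.mul_sum, ← Finset.sum_add_distrib]
    exact Finset.sum_congr rfl fun b _ => by rw [sum_normSq_eq_quarter_skew_add_herm (Y b)]; ring
  have key : ∑ b : PBond P 0, ∑ a : Fin N, ∑ b' : Fin N, Complex.normSq ((Y b) a b')
      - (1 / 4) * ∑ b : PBond P 0, ∑ a : Fin N, ∑ b' : Fin N, Complex.normSq ((Y b + (Y b)ᴴ) a b')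
      = (1 / 4) * ∑ b : PBond P 0, ∑ a : Fin N, ∑ b' : Fin N, Complex.normSq ((Y b - (Y b)ᴴ) a b') := by
    rw [hpar]; ring
  nlinarith [hA, hθ, key]

/-- ★★ **THE k-UNIFORM READING FOR UNITARY PERTURBATIONS** (`d = 3`, `k ≤ m + K`): for `Y(b) = V(b) − 1` with `V(b)` unitary, `‖Y(b)‖ ≤ s`, and `∂^*Y` HERMITIAN
off the `k`-centres (the pinned `ℓ²`-optimum at the flat background, ✓ p605285),
`(1 − N·s²∕4)·Σ_b |Y(b)|²_F ≤ (8400N²L⁴∕(√L − 1)² + 97∕8)·(L^k)²·Σ_p |(∂Y)(p)|²_F + 28·L^k·Σ_c |(Q^{(k)}Y)(c)|²_F` — NO divergence source, NO `(L^k)^3`: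
the quadratic off-centre divergence lives in `Y + Yᴴ = −YᴴY`, which costs `N·s²∕4` of the mass with no lattice factor.
[cite: Balaban1984PropagatorsI, Prop. 1.1 (1.90) p.33; Balaban1985Variational, Prop. 7 p.299, (4) p.278] -/
theorem sum_normSq_le_of_hermDiv_of_polar (hd : P.d = 3) [NeZero N]
    (Q : (i : ℕ) → (PBond P 0 → Matrix (Fin N) (Fin N) ℂ) → PBond P i → Matrix (Fin N) (Fin N) ℂ)
    (hQ0 : ∀ Y, Q 0 Y = Y)
    (hQs : ∀ (i : ℕ) (Y : PBond P 0 → Matrix (Fin N) (Fin N) ℂ) (c : PBond P (i + 1)), Q (i + 1) Y c = linAvg (Q i Y) c)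
    (V Y : PBond P 0 → Matrix (Fin N) (Fin N) ℂ) (hV : ∀ b, V b ∈ Matrix.unitaryGroup (Fin N) ℂ) (hY : ∀ b, Y b = V b - 1)
    {s : ℝ} (hs : ∀ b, ‖Y b‖ ≤ s) {k : ℕ} (hk : k ≤ P.m + P.K)
    (hherm : ∀ x : Site P 0, x ∉ Set.range (embIter k) → (diverg 1 Y x)ᴴ = diverg 1 Y x) :
    (1 - N * s ^ 2 / 4) * ∑ b : PBond P 0, ∑ a : Fin N, ∑ b' : Fin N, Complex.normSq ((Y b) a b')
      ≤ (8400 * (N : ℝ) ^ 2 * (P.L : ℝ) ^ 4 / (Real.sqrt P.L - 1) ^ 2 + 97 / 8) * ((P.L : ℝ) ^ k) ^ 2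
          * ∑ p : Plaq P 0, ∑ a : Fin N, ∑ b' : Fin N, Complex.normSq ((curl 1 Y p) a b')
        + 28 * (P.L : ℝ) ^ k * ∑ c : PBond P k, ∑ a : Fin N, ∑ b' : Fin N, Complex.normSq ((Q k Y c) a b') := by
  have hbud : ∑ b : PBond P 0, ∑ a : Fin N, ∑ b' : Fin N, Complex.normSq ((Y b + (Y b)ᴴ) a b')
      ≤ (N * s ^ 2) * ∑ b : PBond P 0, ∑ a : Fin N, ∑ b' : Fin N, Complex.normSq ((Y b) a b') := by
    rw [Finset.mul_sum]
    refine Finset.sum_le_sum fun b _ => ?_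
    have hsb : ‖V b - 1‖ ≤ s := by rw [← hY b]; exact hs b
    simpa only [← hY b] using sum_normSq_add_conjTranspose_le_of_unitary (hV b) hsb
  have h := sum_normSq_le_of_hermDiv_of_hermBudget hd Q hQ0 hQs Y hk hherm (N * s ^ 2) hbud
  simpa only [mul_div_assoc] using h

/-- ★ **THE T³ INSTANCE** (run `K` of a T³ family, comparison height `n`, `k = K − n`, `d = 3`). [cite: Balaban1985Variational, Prop. 7 p.299, (4) p.278] -/
theorem sum_normSq_le_of_hermDiv_of_polar_T3 (F : T3ContinuumYM3Torus.T3Family) (K n : ℕ) [NeZero N]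
    (Q : (i : ℕ) → (PBond (F.P K) 0 → Matrix (Fin N) (Fin N) ℂ) → PBond (F.P K) i → Matrix (Fin N) (Fin N) ℂ)
    (hQ0 : ∀ Y, Q 0 Y = Y)
    (hQs : ∀ (i : ℕ) (Y : PBond (F.P K) 0 → Matrix (Fin N) (Fin N) ℂ) (c : PBond (F.P K) (i + 1)), Q (i + 1) Y c = linAvg (Q i Y) c)
    (V Y : PBond (F.P K) 0 → Matrix (Fin N) (Fin N) ℂ) (hV : ∀ b, V b ∈ Matrix.unitaryGroup (Fin N) ℂ) (hY : ∀ b, Y b = V b - 1)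
    {s : ℝ} (hs : ∀ b, ‖Y b‖ ≤ s)
    (hherm : ∀ x : Site (F.P K) 0, x ∉ Set.range (embIter (K - n)) → (diverg 1 Y x)ᴴ = diverg 1 Y x) :
    (1 - N * s ^ 2 / 4) * ∑ b : PBond (F.P K) 0, ∑ a : Fin N, ∑ b' : Fin N, Complex.normSq ((Y b) a b')
      ≤ (8400 * (N : ℝ) ^ 2 * (F.L : ℝ) ^ 4 / (Real.sqrt F.L - 1) ^ 2 + 97 / 8) * ((F.L : ℝ) ^ (K - n)) ^ 2
          * ∑ p : Plaq (F.P K) 0, ∑ a : Fin N, ∑ b' : Fin N, Complex.normSq ((curl 1 Y p) a b')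
        + 28 * (F.L : ℝ) ^ (K - n) * ∑ c : PBond (F.P K) (K - n), ∑ a : Fin N, ∑ b' : Fin N, Complex.normSq ((Q (K - n) Y c) a b') := by
  have hk : K - n ≤ (F.P K).m + (F.P K).K := by
    have := F.hm
    show K - n ≤ F.m + K
    omega
  exact sum_normSq_le_of_hermDiv_of_polar (P := F.P K) (T3ContinuumYM3Torus.T3Family.P_d F K) Q hQ0 hQs V Y hV hY hs hk hherm

end Summit.QuantumFields.YangMills.Theorems.Prop7PinnedSkewSplit

end
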